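import Summits.Ventures.Crystal3D.Theorems.StickyWulffConstantCoaxialWallLawFrame
import HarnessLib

/-!
# A co-axial grain is an fcc Barlow stacking: the Hägg sequence of its frame is constant

HONEST FRAMING. Part of the venture `Summits/Ventures/Crystal3D` (cell `crystal3d-full`), helper
`--supports` the crux `CoaxialWallLaw` (stmt-Ventures-19481, `route-Ventures-StickyWulffConstant`),
REGISTERED line `WallLedgerF` (planner cf-p1 gen 16), stub `stub_coaxialTwoSlabAdhesion`.
Frame normalisation step (assembly bookkeeping; continues `…CoaxialWallLawFrame`).

The crux's co-axiality hypothesis presents each grain `A·Λ₀ + t` inside the image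
`L·B(σ) + s` of SOME ideal Barlow stacking `B(σ) = barlowStacking 1 √(2/3) σ` (`σ` a Hägg
sequence); `movedFcc_eq_barlowImage` upgraded this to an equality of point sets.  A moved fcc
lattice is closed under `x ↦ x + (y − z)` for its own points (`movedFcc_add_sub_mem`); a Barlow
stacking with this property has a CONSTANT Hägg sequence (`barlowImage_hagg_succ_eq`: translating
the site `(k+1, 0, 0)` by the inter-layer vector from `(k, 0, 0)` to `(k+1, 0, 0)` must land on
layer `k + 2`, which forces `σ(k) ≡ σ(k+1) (mod 3)`, hence `σ(k) = σ(k+1)`), so `σ ≡ 1` (the model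
lattice `Λ₀` itself: `coaxial_frame_eq_fcc_of_one`, and then the grain IS `L·Λ₀ + s` with the SHARED
axis `L e₃` — the form in which `inPlane_vacancies_ge_sine` (`…CoaxialWallLawInPlaneCount`) applies
with the crux's sine `√(1 − ⟪L e₃, e₃⟫²)`) or `σ ≡ −1` (the twin stacking, `= Λ₀` rotated by `π`
about `e₃`; packaging that rotation as a `LinearIsometryEquiv` is left to the assembly).

* `movedFcc_add_sub_mem` — `x + (y − z) ∈ A·Λ₀ + t` for `x, y, z ∈ A·Λ₀ + t`;
* `barlowImage_hagg_succ_eq` — difference-closed `L·B(σ) + s` ⇒ `σ (k+1) = σ k` for all `k`;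
* `hagg_const_of_succ_eq` — hence `σ k = σ 0`;
* `coaxial_hagg_const` — under the crux's hypothesis for one grain, `σ k = σ 0` for all `k`;
* `coaxial_frame_eq_fcc_of_one` — if moreover `σ 0 = 1`: `A·Λ₀ + t = L·Λ₀ + s`.

WHAT THIS IS NOT: the `σ ≡ −1` repackaging; the stub; rung F-C1 not moved.
-/

noncomputable section

namespace Summit.Ventures.Crystal3D.Theorems

open Summit.Ventures.Crystal3D
open Literature.MathematicalPhysics.StatisticalMechanics (barlowPos barlowStacking fccStacking
  constHagg IsHaggSeq haggLabel haggLabel_succ barlowPos_mem barlowPos_apply_one barlowPos_apply_two)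
open scoped InnerProductSpace

/-- A moved fcc lattice is closed under `x ↦ x + (y − z)` for its own points. -/
theorem movedFcc_add_sub_mem
    (A : EuclideanSpace ℝ (Fin 3) ≃ₗᵢ[ℝ] EuclideanSpace ℝ (Fin 3)) (t : EuclideanSpace ℝ (Fin 3))
    {x y z : EuclideanSpace ℝ (Fin 3)}
    (hx : x ∈ (fun p => A p + t) '' fccStacking 1 (Real.sqrt (2 / 3)))
    (hy : y ∈ (fun p => A p + t) '' fccStacking 1 (Real.sqrt (2 / 3)))
    (hz : z ∈ (fun p => A p + t) '' fccStacking 1 (Real.sqrt (2 / 3))) :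
    x + (y - z) ∈ (fun p => A p + t) '' fccStacking 1 (Real.sqrt (2 / 3)) := by
  obtain ⟨p, hp, rfl⟩ := hx
  obtain ⟨q, hq, rfl⟩ := hy
  obtain ⟨r, hr, rfl⟩ := hz
  refine ⟨p + (q - r), fcc_add_site_mem hp (fcc_sub_site_mem hq hr), ?_⟩
  simp only [map_add, map_sub]
  abel

/-- **Difference-closed Barlow images have constant Hägg sequence (one step).**  If
`L·B(σ) + s` (`σ` Hägg) is closed under `x ↦ x + (y − z)`, then `σ (k+1) = σ k` for every `k`. -/
theorem barlowImage_hagg_succ_eq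
    (L : EuclideanSpace ℝ (Fin 3) ≃ₗᵢ[ℝ] EuclideanSpace ℝ (Fin 3)) (s : EuclideanSpace ℝ (Fin 3))
    {σ : ℤ → ℤ} (hσ : IsHaggSeq σ)
    (hclosed : ∀ x ∈ (fun p => L p + s) '' barlowStacking 1 (Real.sqrt (2 / 3)) σ,
      ∀ y ∈ (fun p => L p + s) '' barlowStacking 1 (Real.sqrt (2 / 3)) σ,
      ∀ z ∈ (fun p => L p + s) '' barlowStacking 1 (Real.sqrt (2 / 3)) σ,
      x + (y - z) ∈ (fun p => L p + s) '' barlowStacking 1 (Real.sqrt (2 / 3)) σ)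
    (k : ℤ) : σ (k + 1) = σ k := by
  set p₀ := barlowPos 1 (Real.sqrt (2 / 3)) σ k 0 0 with hp₀
  set p₁ := barlowPos 1 (Real.sqrt (2 / 3)) σ (k + 1) 0 0 with hp₁
  have hmem : ∀ p, p ∈ barlowStacking 1 (Real.sqrt (2 / 3)) σ →
      L p + s ∈ (fun p => L p + s) '' barlowStacking 1 (Real.sqrt (2 / 3)) σ :=
    fun p hp => ⟨p, hp, rfl⟩
  have h := hclosed _ (hmem p₁ (barlowPos_mem _ _ _)) _ (hmem p₁ (barlowPos_mem _ _ _)) _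
    (hmem p₀ (barlowPos_mem _ _ _))
  obtain ⟨q, ⟨k', i, j, rfl⟩, hq⟩ := h
  -- cancel the rigid motion: `q = p₁ + (p₁ - p₀)`
  have hq' : barlowPos 1 (Real.sqrt (2 / 3)) σ k' i j = p₁ + (p₁ - p₀) := by
    apply L.injective
    have : L p₁ + s + (L p₁ + s - (L p₀ + s)) = L (p₁ + (p₁ - p₀)) + s := by
      simp only [map_add, map_sub]; abel
    rw [this] at hq
    exact add_right_cancel hq
  -- heights: `k' = k + 2`
  have hh : (0 : ℝ) < Real.sqrt (2 / 3) := Real.sqrt_pos.2 (by norm_num)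
  have h2 := congrArg (fun v : EuclideanSpace ℝ (Fin 3) => v 2) hq'
  simp only [PiLp.add_apply, PiLp.sub_apply, hp₀, hp₁, barlowPos_apply_two] at h2
  push_cast at h2
  have hk' : (k' : ℝ) = k + 2 := by
    have : ((k' : ℝ) - (k + 2)) * Real.sqrt (2 / 3) = 0 := by linarith
    rcases mul_eq_zero.1 this with h0 | h0
    · linarith
    · exact absurd h0 (ne_of_gt hh)
  have hk'ℤ : k' = k + 2 := by exact_mod_cast hk'
  subst hk'ℤ
  -- second coordinate: `2 L(k+1) − L(k) − L(k+2) = 3 j`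
  have h1 := congrArg (fun v : EuclideanSpace ℝ (Fin 3) => v 1) hq'
  simp only [PiLp.add_apply, PiLp.sub_apply, hp₀, hp₁, barlowPos_apply_one] at h1
  push_cast at h1
  have h3 : Real.sqrt 3 ≠ 0 := Real.sqrt_ne_zero'.2 (by norm_num)
  have hlab : (haggLabel σ (k + 2) : ℝ) + 3 * j = 2 * haggLabel σ (k + 1) - haggLabel σ k := by
    have e : 1 * Real.sqrt 3 / 2 * ((j : ℝ) + (haggLabel σ (k + 2) : ℝ) / 3) =
        1 * Real.sqrt 3 / 2 * ((0 : ℝ) + (haggLabel σ (k + 1) : ℝ) / 3) +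
          (1 * Real.sqrt 3 / 2 * ((0 : ℝ) + (haggLabel σ (k + 1) : ℝ) / 3) -
            1 * Real.sqrt 3 / 2 * ((0 : ℝ) + (haggLabel σ k : ℝ) / 3)) := by
      simpa using h1
    field_simp at e
    linarith
  have hlabℤ : haggLabel σ (k + 2) + 3 * j = 2 * haggLabel σ (k + 1) - haggLabel σ k := by
    exact_mod_cast hlab
  have hs1 : haggLabel σ (k + 1) = haggLabel σ k + σ k := haggLabel_succ σ k
  have hs2 : haggLabel σ (k + 2) = haggLabel σ (k + 1) + σ (k + 1) := by
    have := haggLabel_succ σ (k + 1)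
    rw [show k + 1 + 1 = k + 2 by ring] at this
    exact this
  -- `σ k − σ (k+1) = 3 j` with both in `{±1}`
  rcases hσ k with ha | ha <;> rcases hσ (k + 1) with hb | hb <;> omega

/-- A sequence with `σ (k+1) = σ k` for all `k` is constant. -/
theorem hagg_const_of_succ_eq {σ : ℤ → ℤ} (h : ∀ k, σ (k + 1) = σ k) (k : ℤ) : σ k = σ 0 := by
  induction k using Int.induction_on with
  | zero => rfl
  | succ n ih => rw [h, ih]
  | pred n ih =>
    have := h (-(n : ℤ) - 1)
    rw [show -(n : ℤ) - 1 + 1 = -(n : ℤ) by ring] at this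
    rw [← this, ih]

/-- **The Hägg sequence of a co-axial frame is constant.**  Under the crux's co-axiality
hypothesis for the grain `A·Λ₀ + t` with frame `(L, s, σ)`: `σ k = σ 0` for all `k`. -/
theorem coaxial_hagg_const
    (A : EuclideanSpace ℝ (Fin 3) ≃ₗᵢ[ℝ] EuclideanSpace ℝ (Fin 3)) (t : EuclideanSpace ℝ (Fin 3))
    (L : EuclideanSpace ℝ (Fin 3) ≃ₗᵢ[ℝ] EuclideanSpace ℝ (Fin 3)) (s : EuclideanSpace ℝ (Fin 3))
    {σ : ℤ → ℤ} (hσ : IsHaggSeq σ)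
    (hsub : (fun p => A p + t) '' fccStacking 1 (Real.sqrt (2 / 3)) ⊆
      (fun p => L p + s) '' barlowStacking 1 (Real.sqrt (2 / 3)) σ) (k : ℤ) :
    σ k = σ 0 := by
  have heq := movedFcc_eq_barlowImage A t L s hσ hsub
  refine hagg_const_of_succ_eq (fun k => barlowImage_hagg_succ_eq L s hσ ?_ k) k
  intro x hx y hy z hz
  rw [← heq] at hx hy hz ⊢
  exact movedFcc_add_sub_mem A t hx hy hz

/-- **Frame normalisation, fcc word.**  If the frame's Hägg sequence has `σ 0 = 1`, the grain is
`L·Λ₀ + s` (same point set), so every statement about `A·Λ₀ + t` phrased through the set applies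
with `(L, s)` — whose axis `L e₃` is the SHARED axis of the co-axial pair. -/
theorem coaxial_frame_eq_fcc_of_one
    (A : EuclideanSpace ℝ (Fin 3) ≃ₗᵢ[ℝ] EuclideanSpace ℝ (Fin 3)) (t : EuclideanSpace ℝ (Fin 3))
    (L : EuclideanSpace ℝ (Fin 3) ≃ₗᵢ[ℝ] EuclideanSpace ℝ (Fin 3)) (s : EuclideanSpace ℝ (Fin 3))
    {σ : ℤ → ℤ} (hσ : IsHaggSeq σ)
    (hsub : (fun p => A p + t) '' fccStacking 1 (Real.sqrt (2 / 3)) ⊆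
      (fun p => L p + s) '' barlowStacking 1 (Real.sqrt (2 / 3)) σ)
    (h0 : σ 0 = 1) :
    (fun p => A p + t) '' fccStacking 1 (Real.sqrt (2 / 3)) =
      (fun p => L p + s) '' fccStacking 1 (Real.sqrt (2 / 3)) := by
  have hconst : σ = constHagg := by
    funext k
    rw [coaxial_hagg_const A t L s hσ hsub k, h0]
    rfl
  rw [movedFcc_eq_barlowImage A t L s hσ hsub, hconst]
  rfl

end Summit.Ventures.Crystal3D.Theorems

end
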